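import Summits.PneNP.PneNP.Theorems.SliceTarget.Negative.WitnessShape
import Summits.PneNP.PneNP.Theorems.OneSliceSliceMonotonization

/-!
# `SliceTarget` (stmt-PneNP-2832) — negative-side lemmas III: X is a statement about GENERAL circuits; the weakenings
# of X that still close the route

* §4 `SliceLBOver B`, `SliceTargetB2`; `eventually_central_pos_lt` (eventually every central `j` has `0 < j < C(n,2)`, via
  `thr_ge`: `m_k(n) ≥ (n-1)/2 - 1`); `sliceTargetB2_of_sliceTarget`, **`sliceTarget_iff_B2 (hM : SliceMonotonization) :
  SliceTarget ↔ SliceTargetB2`** (Berkowitz on one slice; `SliceMonotonization` is the route's support item, proved in tree as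
  `Summit.PneNP.PneNP.Theorems.sliceMonotonization_proof`), `not_sliceTarget_of_B2_kill`; §4b the UNCONDITIONAL forms
  `sliceTarget_iff_B2_holds : SliceTarget ↔ SliceTargetB2` and `not_sliceTarget_iff_B2` (a kill may use negations: one
  exponent `c` with small accurate `B₂`-circuits on central slices for every `k`, `δ`).
* §5 `SliceTargetExact` (`δ = 0`), `SliceTargetIO` (`∃ᶠ n`), `SliceTargetExactIO`, `SliceTargetMin` (exact, central slice only,
  i.o.) — each implied by X and each sufficient for the route's assembly (which uses X at `j = m_k(n)`, error `0`, one large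
  `n`); `exactIO_exponent_lt` (`k > c` even there).

Refuter seat cdisprove-stmt-PneNP-2832 (gen 1), 2026-08-16; see `LoadBearing.lean`, `WitnessShape.lean`.
-/

set_option linter.dupNamespace false

namespace Summit.PneNP.PneNP.Theorems.SliceTarget.Negative

open Literature.Computability.Complexity Filter Finset Classical
open Summit.PneNP.PneNP.Theses.OneSlice (SliceTarget ConstantBand SliceMonotonization)
open Summit.PneNP.PneNP.Theorems.ConstantBand.Negative (Edge thr Central central_thr slice errSet bandErr
  BandLB bandErr_eq_zero_of_eval exists_oneGate_cliqueFn cliqueFn_eq_true_of_card_false_le le_choose_two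
  exists_orAll)
open Summit.PneNP.PneNP.Theorems.SliceACZero.Negative (mk sliceCard sliceErr sliceCard_eq card_slice_supset_le
  choose_sub_mul_pow_le_choose_mul_pow firstMoment_slice mk_le_choose choose_le_edgeCount_of_cliqueFn
  eq_false_of_edgeCount_eq_zero eq_true_of_edgeCount_eq cliqueFn_false cliqueFn_true exists_edge input_facts
  factorial_inv_le_of_ceil_lt)
open Summit.PneNP.PneNP.Theorems.SingleThreshold.Negative (pc pc_nonneg pc_le_one tendsto_pc
  exists_monotone_cliqueCircuit choose_mul_le_pow)

/-! ## §4 X is a statement about GENERAL circuits (Berkowitz on one slice, kernel-checked)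

The `B₂` form of X (`SliceTargetB2` in the work file; stated inline here as `∀ c ∃ k ≥ 3 ∃ δ > 0, SliceLBOver B2 c k δ`) is the crux with `{∧₂, ∨₂}` replaced by the full binary basis `B₂` (all sixteen fan-in-2 gates,
constants, negation). `sliceTarget_iff_B2`: modulo the route's support item `SliceMonotonization` (Berkowitz's
pseudo-complements; PROVED in tree as `Summit.PneNP.PneNP.Theorems.sliceMonotonization_proof`, taken here as a
hypothesis so that this file does not depend on that module) the two are EQUIVALENT. So a kill of X may use
negations freely: X is refuted by ONE exponent `c` such that for every `k` general size-`n^c` circuits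
`δ`-approximate `k`-CLIQUE on a central slice for every `δ > 0` — a fixed-exponent average-case clique
algorithm at criticality — and by nothing weaker. -/

/-- The crux's inner clause over an arbitrary gate basis `B`. [folklore] -/
def SliceLBOver (B : Set GateFn) (c k : ℕ) (δ : ℝ) : Prop :=
  ∀ᶠ n : ℕ in atTop, ∀ j : ℕ, Central k n j → ∀ C : Circuit (Edge n), C.IsOver B →
    (#(errSet n k j C) : ℝ) ≤ δ * #(slice n j) → n ^ c < C.size

/-- Over `{∧₂, ∨₂}` this is `SliceLB`. [folklore] -/
theorem sliceLBOver_monotone_iff {c k : ℕ} {δ : ℝ} : SliceLBOver monotoneBasis c k δ ↔ SliceLB c k δ := Iff.rfl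

/-- A larger basis gives a stronger lower-bound claim. [folklore] -/
theorem SliceLBOver.anti_basis {B B' : Set GateFn} {c k : ℕ} {δ : ℝ} (h : B ⊆ B') (H : SliceLBOver B' c k δ) :
    SliceLBOver B c k δ := by
  filter_upwards [H] with n hn j hj C hC herr
  exact hn j hj C (hC.mono h) herr

/-- `{∧₂, ∨₂} ⊆ B₂`. [folklore] -/
theorem monotoneBasis_subset_B2 : monotoneBasis ⊆ B2 :=
  monotoneBasis_subset_deMorgan.trans deMorganBasis_subset_B2

/-- `n^{-1} ≤ n^{-2/(k-1)}` for `k ≥ 3`. [folklore] -/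
theorem inv_le_rpow_threshold {k n : ℕ} (hk : 3 ≤ k) (hn : 1 ≤ n) :
    (n : ℝ)⁻¹ ≤ (n : ℝ) ^ (-(2 : ℝ) / ((k : ℝ) - 1)) := by
  have hn1 : (1 : ℝ) ≤ n := by exact_mod_cast hn
  rw [← Real.rpow_neg_one]
  apply Real.rpow_le_rpow_of_exponent_le hn1
  have hk' : (3 : ℝ) ≤ k := by exact_mod_cast hk
  rw [neg_div, neg_le_neg_iff, div_le_one (by linarith)]
  linarith

/-- **The threshold edge count is unbounded**: `m_k(n) ≥ (n-1)/2 - 1` for `k ≥ 3`. [folklore] -/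
theorem thr_ge {k n : ℕ} (hk : 3 ≤ k) (hn : 1 ≤ n) : ((n : ℝ) - 1) / 2 - 1 ≤ thr k n := by
  have hT : ((n : ℝ) - 1) / 2 ≤ (n.choose 2 : ℕ) * (n : ℝ) ^ (-(2 : ℝ) / ((k : ℝ) - 1)) := by
    have hn0 : (n : ℝ) ≠ 0 := by exact_mod_cast (show n ≠ 0 by omega)
    calc ((n : ℝ) - 1) / 2 = (n.choose 2 : ℕ) * (n : ℝ)⁻¹ := by
          rw [Nat.cast_choose_two]; field_simp
      _ ≤ _ := mul_le_mul_of_nonneg_left (inv_le_rpow_threshold hk hn) (Nat.cast_nonneg _)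
  have hfl := Nat.lt_floor_add_one (((n.choose 2 : ℕ) : ℝ) * (n : ℝ) ^ (-(2 : ℝ) / ((k : ℝ) - 1)))
  rw [thr]
  linarith

/-- Central edge counts lie in `[m - m^{3/4}, 2m]` once `m = m_k(n) ≥ 1`. [folklore] -/
theorem central_bounds {k n j : ℕ} (hj : Central k n j) (h1 : 1 ≤ thr k n) :
    (thr k n : ℝ) - (thr k n : ℝ) ^ ((3 : ℝ) / 4) ≤ j ∧ (j : ℝ) ≤ 2 * thr k n := by
  have hpow : (thr k n : ℝ) ^ ((3 : ℝ) / 4) ≤ thr k n := by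
    have h1' : (1 : ℝ) ≤ thr k n := by exact_mod_cast h1
    calc (thr k n : ℝ) ^ ((3 : ℝ) / 4) ≤ (thr k n : ℝ) ^ (1 : ℝ) :=
          Real.rpow_le_rpow_of_exponent_le h1' (by norm_num)
      _ = thr k n := Real.rpow_one _
  obtain ⟨hlo, hhi⟩ := abs_sub_le_iff.1 hj
  constructor <;> linarith

/-- A central edge count is positive once `m_k(n) ≥ 2` (`|0 - m| ≤ m^{3/4}` forces `m ≤ 1`). [folklore] -/
theorem pos_of_central {k n j : ℕ} (hj : Central k n j) (h2 : 2 ≤ thr k n) : 0 < j := by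
  by_contra hj0
  obtain rfl : j = 0 := by omega
  rw [Central, Nat.cast_zero, zero_sub, abs_neg, Nat.abs_cast] at hj
  have h2' : (1 : ℝ) < thr k n := by exact_mod_cast h2
  have hlt : (thr k n : ℝ) ^ ((3 : ℝ) / 4) < (thr k n : ℝ) ^ (1 : ℝ) :=
    Real.rpow_lt_rpow_of_exponent_lt h2' (by norm_num)
  rw [Real.rpow_one] at hlt
  linarith

/-- **Eventually every central `j` satisfies `0 < j < C(n,2)`** (`k ≥ 3`): the hypotheses of
`SliceMonotonization` hold on the whole window. [folklore] -/
theorem eventually_central_pos_lt {k : ℕ} (hk : 3 ≤ k) :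
    ∀ᶠ n : ℕ in atTop, ∀ j : ℕ, Central k n j → 0 < j ∧ j < n.choose 2 := by
  have hpc : ∀ᶠ n : ℕ in atTop, pc n k < 1 / 2 :=
    (tendsto_pc (by omega)).eventually (gt_mem_nhds (by norm_num))
  filter_upwards [hpc, eventually_ge_atTop 7] with n hp hn j hj
  have hthr : (2 : ℝ) ≤ thr k n := by
    have h := thr_ge hk (by omega : 1 ≤ n)
    have h7 : (7 : ℝ) ≤ n := by exact_mod_cast hn
    linarith
  have hthr' : 2 ≤ thr k n := by exact_mod_cast hthr
  refine ⟨pos_of_central hj hthr', ?_⟩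
  have hjle := (central_bounds hj (by omega)).2
  have hT : (thr k n : ℝ) ≤ (n.choose 2 : ℕ) * pc n k := by
    rw [pc]; exact Nat.floor_le (by positivity)
  have hN : (0 : ℝ) < (n.choose 2 : ℕ) := by exact_mod_cast Nat.choose_pos (by omega)
  have hlt : (j : ℝ) < n.choose 2 := by nlinarith
  exact_mod_cast hlt

/-- Size bookkeeping: `c₀(n^c + n^{c₀}) < n^{c+c₀+1}` for `n > 2c₀`. [folklore] -/
theorem eventually_monotonization_small (c c₀ : ℕ) :
    ∀ᶠ n : ℕ in atTop, c₀ * (n ^ c + n ^ c₀) < n ^ (c + c₀ + 1) := by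
  filter_upwards [eventually_gt_atTop (2 * c₀)] with n hn
  have hn1 : 1 ≤ n := by omega
  have h1 : n ^ c ≤ n ^ (c + c₀) := Nat.pow_le_pow_right hn1 (by omega)
  have h2 : n ^ c₀ ≤ n ^ (c + c₀) := Nat.pow_le_pow_right hn1 (by omega)
  have hX : 0 < n ^ (c + c₀) := Nat.pow_pos hn1
  have h3 : n ^ (c + c₀ + 1) = n ^ (c + c₀) * n := pow_succ _ _
  rw [h3]
  nlinarith

/-- **X ⟹ its general-circuit form** (modulo Berkowitz's monotonization with constant `c₀`): a `B₂`-circuit of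
size `≤ n^c`, `δ`-accurate on a central slice `j` (`0 < j < C(n,2)` eventually), monotonizes to a `{∧₂,∨₂}`-circuit
with the SAME error set and `≤ c₀(n^c + n^{c₀}) < n^{c+c₀+1}` gates, contradicting X at exponent `c + c₀ + 1`. [folklore] -/
theorem sliceTargetB2_of_sliceTarget (hM : SliceMonotonization) (hT : SliceTarget) :
    ∀ c : ℕ, ∃ k : ℕ, 3 ≤ k ∧ ∃ δ : ℝ, 0 < δ ∧ SliceLBOver B2 c k δ := by
  intro c
  obtain ⟨c₀, hc₀⟩ := hM
  obtain ⟨k, hk, δ, hδ, H⟩ := (sliceTarget_iff.1 hT) (c + c₀ + 1)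
  refine ⟨k, hk, δ, hδ, ?_⟩
  filter_upwards [H, eventually_central_pos_lt hk, eventually_monotonization_small c c₀] with n hn hcen hsm j hj
    C hCB herr
  obtain ⟨hj0, hjN⟩ := hcen j hj
  by_contra hsize
  obtain ⟨C', hC'B, hC's, hC'e⟩ := hc₀ n j C hCB hj0 hjN
  have herr' : (#(errSet n k j C') : ℝ) ≤ δ * #(slice n j) := by
    rwa [errSet_congr (C := C) (C' := C') fun x hx => hC'e x hx]
  have hlt := hn j hj C' hC'B herr'
  have hle : C'.size ≤ c₀ * (n ^ c + n ^ c₀) :=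
    hC's.trans (Nat.mul_le_mul_left _ (Nat.add_le_add_right (not_lt.1 hsize) _))
  omega

/-- **`SliceTarget ↔ SliceTargetB2`** (modulo `SliceMonotonization`, proved in tree): on one slice, syntactic
monotonicity costs only a polynomial, so X is a fixed-polynomial AVERAGE-CASE lower bound for GENERAL circuits
computing the P-functions `CLIQUE_k` on the critical slice. [folklore] -/
theorem sliceTarget_iff_B2 (hM : SliceMonotonization) :
    SliceTarget ↔ ∀ c : ℕ, ∃ k : ℕ, 3 ≤ k ∧ ∃ δ : ℝ, 0 < δ ∧ SliceLBOver B2 c k δ := by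
  refine ⟨sliceTargetB2_of_sliceTarget hM, fun h c => ?_⟩
  -- trivial direction: a lower bound against `B₂`-circuits is one against `{∧₂, ∨₂}`-circuits
  obtain ⟨k, hk, δ, hδ, H⟩ := h c
  exact ⟨k, hk, δ, hδ, H.anti_basis monotoneBasis_subset_B2⟩

/-- **What a kill may use**: negations. Modulo `SliceMonotonization`, X is refuted by one exponent `c` with,
for every `k ≥ 3` and `δ > 0`, infinitely many `n` carrying a GENERAL `B₂`-circuit of size `≤ n^c` that is
`δ`-accurate for `CLIQUE_k` on some central slice. [folklore] -/
theorem not_sliceTarget_of_B2_kill (hM : SliceMonotonization)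
    (h : ∃ c : ℕ, ∀ k : ℕ, 3 ≤ k → ∀ δ : ℝ, 0 < δ → ∃ᶠ n : ℕ in atTop, ∃ j : ℕ, Central k n j ∧
      ∃ C : Circuit (Edge n), C.IsOver B2 ∧ (#(errSet n k j C) : ℝ) ≤ δ * #(slice n j) ∧ C.size ≤ n ^ c) :
    ¬ SliceTarget := by
  intro hT
  obtain ⟨c, hc⟩ := h
  obtain ⟨k, hk, δ, hδ, H⟩ := sliceTargetB2_of_sliceTarget hM hT c
  have hfr := hc k hk δ hδ
  have : ∃ᶠ n : ℕ in atTop, False := by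
    refine (hfr.and_eventually H).mono ?_
    rintro n ⟨⟨j, hj, C, hCB, herr, hs⟩, hn⟩
    exact absurd (hn j hj C hCB herr) (not_lt.2 hs)
  exact frequently_false _ this

/-! ### §4b Unconditionally: `SliceMonotonization` is a tree theorem (`sliceMonotonization_proof`, item 2836, p78537) -/

/-- **`SliceTarget ↔ SliceTargetB2`, unconditionally** (Berkowitz's monotonization is proved in tree). [folklore] -/
theorem sliceTarget_iff_B2_holds :
    SliceTarget ↔ ∀ c : ℕ, ∃ k : ℕ, 3 ≤ k ∧ ∃ δ : ℝ, 0 < δ ∧ SliceLBOver B2 c k δ :=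
  sliceTarget_iff_B2 Summit.PneNP.PneNP.Theorems.sliceMonotonization_proof

/-- **Kill transfer, unconditionally**: small accurate GENERAL circuits on central slices for every `k, δ` refute X. [folklore] -/
theorem not_sliceTarget_of_B2_kill_holds
    (h : ∃ c : ℕ, ∀ k : ℕ, 3 ≤ k → ∀ δ : ℝ, 0 < δ → ∃ᶠ n : ℕ in atTop, ∃ j : ℕ, Central k n j ∧
      ∃ C : Circuit (Edge n), C.IsOver B2 ∧ (#(errSet n k j C) : ℝ) ≤ δ * #(slice n j) ∧ C.size ≤ n ^ c) :
    ¬ SliceTarget :=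
  not_sliceTarget_of_B2_kill Summit.PneNP.PneNP.Theorems.sliceMonotonization_proof h

/-- **The general-circuit kill shape, as an equivalence**: `¬X` iff ONE exponent `c` admits, for every `k ≥ 3` and
`δ > 0`, infinitely often a `B₂`-circuit of size `≤ n^c` that is `δ`-accurate for `CLIQUE_k` on a central slice. [folklore] -/
theorem not_sliceTarget_iff_B2 :
    ¬ SliceTarget ↔ ∃ c : ℕ, ∀ k : ℕ, 3 ≤ k → ∀ δ : ℝ, 0 < δ → ∃ᶠ n : ℕ in atTop, ∃ j : ℕ, Central k n j ∧
      ∃ C : Circuit (Edge n), C.IsOver B2 ∧ (#(errSet n k j C) : ℝ) ≤ δ * #(slice n j) ∧ C.size ≤ n ^ c := by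
  constructor
  · intro h
    obtain ⟨c, hc⟩ := not_sliceTarget_iff.1 h
    refine ⟨c, fun k hk δ hδ => (hc k hk δ hδ).mono ?_⟩
    rintro n ⟨j, hj, C, hCB, herr, hs⟩
    exact ⟨j, hj, C, hCB.mono monotoneBasis_subset_B2, herr, hs⟩
  · exact not_sliceTarget_of_B2_kill_holds

/-! ## §5 Weakenings of X that still feed the route's assembly (information for the planner)

The assembly (item 10382) consumes X only at `j = m_k(n)`, with error EXACTLY `0` (the monotonized P/poly circuit is
exact on the slice), and at ONE large `n` per `(c, k)`. Hence each of the following is implied by X, and each still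
closes the route with the same glue: `SliceTargetExact` (worst case on the slice: `δ = 0`), `SliceTargetIO`
(`∃ᶠ n` in place of `∀ᶠ n` — infinitely-often hardness suffices against the EVENTUAL upper bound from `NP ⊆ P/poly`),
and their conjunction-free combination `SliceTargetExactIO`. None of them is refuted here (each implies `NP ⊄ P/poly`
through the assembly); they are recorded because a proof attempt may find the weaker targets easier to state
closure lemmas for, and because a refutation of X that does not refute `SliceTargetExactIO` would leave the route
repairable. -/

/-- The worst-case (exact-on-the-slice) inner clause. [folklore] -/
def SliceLBExact (c k : ℕ) : Prop :=
  ∀ᶠ n : ℕ in atTop, ∀ j : ℕ, Central k n j → ∀ C : Circuit (Edge n), C.IsOver monotoneBasis →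
    (∀ x : Edge n → Bool, edgeCount x = j → C.eval x = cliqueFn n k x) → n ^ c < C.size

/-- `δ`-accuracy lower bounds contain the exact lower bound. [folklore] -/
theorem sliceLBExact_of_sliceLB {c k : ℕ} {δ : ℝ} (hδ : 0 ≤ δ) (H : SliceLB c k δ) : SliceLBExact c k := by
  filter_upwards [H] with n hn j hj C hC hex
  exact hn j hj C hC (by rw [errSet_eq_empty_of hex, card_empty, Nat.cast_zero]; positivity)

/-- X implies its worst-case form `SliceTargetExact` (`δ = 0`: the central-slice functions of `CLIQUE_{k(c)}` have
monotone (= general) circuit complexity `> n^c` for all large `n`). [folklore] -/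
theorem sliceTargetExact_of_sliceTarget (h : SliceTarget) : ∀ c : ℕ, ∃ k : ℕ, 3 ≤ k ∧ SliceLBExact c k := fun c => by
  obtain ⟨k, hk, δ, hδ, H⟩ := sliceTarget_iff.1 h c
  exact ⟨k, hk, sliceLBExact_of_sliceLB hδ.le H⟩

/-- X implies its infinitely-often form `SliceTargetIO` (`∀ᶠ n` weakened to `∃ᶠ n`). [folklore] -/
theorem sliceTargetIO_of_sliceTarget (h : SliceTarget) :
    ∀ c : ℕ, ∃ k : ℕ, 3 ≤ k ∧ ∃ δ : ℝ, 0 < δ ∧ ∃ᶠ n : ℕ in atTop, ∀ j : ℕ, Central k n j →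
      ∀ C : Circuit (Edge n), C.IsOver monotoneBasis → (#(errSet n k j C) : ℝ) ≤ δ * #(slice n j) →
        n ^ c < C.size := fun c => by
  obtain ⟨k, hk, δ, hδ, H⟩ := sliceTarget_iff.1 h c
  exact ⟨k, hk, δ, hδ, H.frequently⟩

/-- X implies `SliceTargetExactIO` (exact on the slice, infinitely often in `n`). [folklore] -/
theorem sliceTargetExactIO_of_sliceTarget (h : SliceTarget) :
    ∀ c : ℕ, ∃ k : ℕ, 3 ≤ k ∧ ∃ᶠ n : ℕ in atTop, ∀ j : ℕ, Central k n j →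
      ∀ C : Circuit (Edge n), C.IsOver monotoneBasis →
        (∀ x : Edge n → Bool, edgeCount x = j → C.eval x = cliqueFn n k x) → n ^ c < C.size := fun c => by
  obtain ⟨k, hk, H⟩ := sliceTargetExact_of_sliceTarget h c
  exact ⟨k, hk, H.frequently⟩

/-- X implies **the minimal form the route actually consumes**, `SliceTargetMin`: exact on the CENTRAL slice
`j = m_k(n)` only, infinitely often in `n` (drops the average case, the almost-everywhere, and the uniformity over the
window) — so a refutation of X that spares it leaves the route repairable by restating X; conversely it is what
`Assembly` needs (`SliceMonotonization` at `M = m_k(n)` and the eventual P/poly circuits meet an infinitely-often lower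
bound just as well). [folklore] -/
theorem sliceTargetMin_of_sliceTarget (h : SliceTarget) :
    ∀ c : ℕ, ∃ k : ℕ, 3 ≤ k ∧ ∃ᶠ n : ℕ in atTop, ∀ C : Circuit (Edge n), C.IsOver monotoneBasis →
      (∀ x : Edge n → Bool, edgeCount x = thr k n → C.eval x = cliqueFn n k x) → n ^ c < C.size := fun c => by
  obtain ⟨k, hk, H⟩ := sliceTargetExactIO_of_sliceTarget h c
  exact ⟨k, hk, H.mono fun n hn C hC hex => hn (thr k n) (central_thr k n) C hC hex⟩

/-- Even the weakest form refutes small `k`: `k ≤ c` is impossible in `SliceTargetExactIO` too (the exact DNF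
exists at EVERY large `n`). [folklore] -/
theorem exactIO_exponent_lt {c k : ℕ} (hk : 3 ≤ k)
    (H : ∃ᶠ n : ℕ in atTop, ∀ j : ℕ, Central k n j → ∀ C : Circuit (Edge n), C.IsOver monotoneBasis →
      (∀ x : Edge n → Bool, edgeCount x = j → C.eval x = cliqueFn n k x) → n ^ c < C.size) :
    c < k := by
  by_contra hc
  have hev : ∀ᶠ n : ℕ in atTop, ¬ ∀ j : ℕ, Central k n j → ∀ C : Circuit (Edge n), C.IsOver monotoneBasis →
      (∀ x : Edge n → Bool, edgeCount x = j → C.eval x = cliqueFn n k x) → n ^ c < C.size := by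
    filter_upwards [eventually_ge_atTop (k + 1)] with n hnk hall
    obtain ⟨C, hCB, hs, he⟩ := exists_monotone_cliqueCircuit (n := n) (k := k) (by omega) (by omega)
    have hlt := hall (thr k n) (central_thr k n) C hCB fun x _ => he x
    have h1 : C.size ≤ n ^ k := hs.trans (dnfSize_le_pow hk)
    have h3 : n ^ k ≤ n ^ c := Nat.pow_le_pow_right (by omega) (not_lt.1 hc)
    omega
  exact H hev

end Summit.PneNP.PneNP.Theorems.SliceTarget.Negative
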